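import Summits.HubbardSuperconductivity.HubbardSuperconductivity.Theses.FixedNodeShadow
import Literature.MathematicalPhysics.QuantumLattice.FixedNode

/-!
# Route `FixedNodeShadow`, support `FnDomination` (item stmt-HubbardSuperconductivity-2106)

F1 DOMINATION. For a complex matrix `A` with real symmetric entries and a real guiding vector `f`,
the fixed-node correction `D = FN(A, f) − A` (inlined in the route statement: diagonal = the
sign-flip potential, `−A i j` on bad pairs, `0` elsewhere) is real symmetric, positive
(`0 ≤ Re ⟨v, D v⟩`), annihilates `f`, and `FN(A, f) = A + D` entrywise. Every clause is a proved
statement of `Literature/MathematicalPhysics/QuantumLattice/FixedNode.lean` once the inlined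
matrices are recognised as `fixedNodeCorrection A f` (`fixedNodeCorrection_eq_of`) and
`fixedNodeMatrix A f` (definitional). Gubernatis–Kawashima–Werner (2016) §11.2, (11.8);
ten Haaf et al., PRB 51 (1995) 13039; Becca–Sorella (2017) §10.4.
-/

-- the mandated namespace `Summit.<Summit>.<Problem>.Theorems` repeats `HubbardSuperconductivity`
-- (single-problem summit, D-0017), which the `dupNamespace` linter flags on every declaration
set_option linter.dupNamespace false

namespace Summit.HubbardSuperconductivity.HubbardSuperconductivity.Theorems.FixedNodeShadow

open Matrix Literature.MathematicalPhysics.QuantumLattice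

/-- **`FnDomination`** (route `FixedNodeShadow`, item stmt-HubbardSuperconductivity-2106): the
inlined fixed-node correction `D` of a real symmetric `A` along `f` is real symmetric, positive,
kills `f`, and `FN(A, f) = A + D`. [cite: GubernatisKawashimaWerner2016, §11.4 eq. (11.8)] -/
theorem fnDomination_proof :
    Summit.HubbardSuperconductivity.HubbardSuperconductivity.Theses.FixedNodeShadow.FnDomination := by
  intro n _ _ A f hsymm hreal D hD
  have hD' : D = fixedNodeCorrection A f := hD.trans (fixedNodeCorrection_eq_of A f).symm
  subst hD'
  refine ⟨fixedNodeCorrection_symm hsymm f, star_fixedNodeCorrection_apply hreal f,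
    fixedNodeCorrection_re_quadForm_nonneg hsymm hreal f, fixedNodeCorrection_mulVec_ofReal hreal f,
    ?_⟩
  exact fixedNodeMatrix_eq_add_fixedNodeCorrection A f

end Summit.HubbardSuperconductivity.HubbardSuperconductivity.Theorems.FixedNodeShadow
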